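import Literature.NumberTheory.Sieve.QuadraticRootsLevelUnfold
import Literature.NumberTheory.Sieve.QuadraticRootsLevelFlat
import HarnessLib

/-!
# The level-form sum of geodesic weights as a sum of cycle integrals (`Δ > 0`)

Topic `Literature/NumberTheory/Sieve`, continuation of `QuadraticRootsLevelUnfold.lean` and
`QuadraticRootsLevelFlat.lean`; the last purely combinatorial layer of the positive-discriminant
(Tóth) analogue of Duke–Friedlander–Iwaniec (14).  `…LevelForms.sum_weylSum_eq_sum_levelForms`
writes the Weyl sum `∑_{n ≤ N, d ∣ n} G(n) ρ_h(n)` of `f = ax² + bx + c` as a sum over the finite set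
`levelFormsUpTo a b c d N` of `T`-reduced level forms `Q = [A, B, C]` (`A > 0`, `q = ad ∣ A`,
`B ≡ b (2a)`, disc `Δ`); `…LevelUnfold.cycleIntegral_poincareFn_eq_tsum` unfolds the geodesic
weights `𝒲_φ` over the `T`-reduced forms of ONE `Γ₀(q)`-orbit into the integral of the Poincaré
series `P_φ` along one closed geodesic.  Here the two are joined:

* invariances of the weight: `geodWeight_negForm` (`𝒲_φ(−Q) = 𝒲_φ(Q)`), `geodWeight_smul_T_zpow`
  (`𝒲_φ(Q·T^j) = 𝒲_φ(Q)` for `T`-invariant `φ`), and **`geodWeight_flat`**: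
  `𝒲_φ(Q♭) = 𝒲_{φ∘ρ}(Q)` with `ρ(x + iy) = −x + iy` — the forms with `A < 0` carry the kernel
  reflected in the imaginary axis (for `φ = e(η Re z)Ψ(Im z)` this is the frequency `−η`:
  the weight-`0` geodesic sums see the Weyl sums at `h` and `−h` together);
* the unfolding for a base form with `A < 0` (`cycleIntegral_poincareFn_eq_tsum_of_neg`, through
  `−R` and `TRedOrbit R q ≃ TRedOrbit (−R) q`);
* `Γ₀(q)`-orbits: `LevelEquiv q`, the canonical representative `orbitRep q Q`, and the
  **orbit-sum identity** `sum_geodWeight_levelFormsUpTo_eq`: for `aN ≥ √Δ/(2Y)` (all geodesics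
  reaching the support of `φ` are counted),

  `∑_{Q ∈ levelFormsUpTo a b c d N} (𝒲_φ(Q) + 𝒲_φ(Q♭)) = ∑_{R ∈ orbit representatives} ∫_{κ_R}^{1} P_φ ds`,

  the right side summed over representatives of the `Γ₀(q)`-orbits met, each integral taken over
  one period of the closed geodesic of `R` on `Γ₀(q)∖ℍ` (any choice of deck generators).

Everything here is proved; nothing of Tóth's paper (cite-only in the store) is vendored.

## References

* Á. Tóth, *Roots of quadratic congruences*, IMRN 2000, no. 14, 719–739 (the Weyl sums for
  `Δ > 0` as sums over closed geodesics of `Γ₀(q)∖ℍ`, unfolded against Poincaré series; cite-only,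
  cf. [cite: Ngo2024, §1]). [cite: Toth2000, main theorem]
* W. Duke, J. B. Friedlander, H. Iwaniec, Ann. of Math. (2) 141 (1995), (14) p. 428 (the model
  identity for `Δ < 0`: level-`q` Heegner points and `P_h(z)`). [cite: DukeFriedlanderIwaniec1995, (14) p. 428]
-/

noncomputable section

namespace Literature.NumberTheory.Sieve

open scoped MatrixGroups UpperHalfPlane
open Literature.NumberTheory.QuadraticFields.Quadratic (BinQF)
open UpperHalfPlane MeasureTheory
open ModularGroup (T)

namespace RootForms

variable {q : ℕ} {R : BinQF}

/-! ### Invariances of the geodesic weight -/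

section invariance

variable {Q : BinQF}

/-- `axisPt₀` only depends on the form (proof-irrelevance across equal forms). [folklore] -/
theorem axisPt₀_congr_form {Q Q' : BinQF} (e : Q = Q') (hA : 0 < Q.a) (hΔ : 0 < Q.disc)
    (hA' : 0 < Q'.a) (hΔ' : 0 < Q'.disc) (t : ℝ) : axisPt₀ Q hA hΔ t = axisPt₀ Q' hA' hΔ' t := by
  subst e; rfl

/-- **`𝒲_φ(−Q) = 𝒲_φ(Q)`** (same geodesic). [folklore] -/
theorem geodWeight_negForm (φ : ℍ → ℂ) (hA : Q.a ≠ 0) (hΔ : 0 < Q.disc) :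
    geodWeight φ (negForm Q) = geodWeight φ Q := by
  rcases lt_or_gt_of_ne hA with hneg | hpos
  · have h1 : 0 < (negForm Q).a := negForm_a_pos.2 hneg
    have h2 : 0 < (negForm Q).disc := by rw [negForm_disc]; exact hΔ
    rw [geodWeight_of_pos φ h1 h2, geodWeight_of_neg φ hneg hΔ h1 h2]
  · have h1 : (negForm Q).a < 0 := by rw [negForm_a, neg_lt_zero]; exact hpos
    have h2 : 0 < (negForm Q).disc := by rw [negForm_disc]; exact hΔ
    have h3 : 0 < (negForm (negForm Q)).a := negForm_a_pos.2 h1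
    have h4 : 0 < (negForm (negForm Q)).disc := by rw [negForm_disc]; exact h2
    rw [geodWeight_of_neg φ h1 h2 h3 h4, geodWeight_of_pos φ hpos hΔ]
    refine setIntegral_congr_fun measurableSet_Ioi fun t _ => ?_
    rw [axisPt₀_congr_form (negForm_negForm Q) h3 h4 hpos hΔ]

/-- `κ(Q, T^j) = 1`. [folklore] -/
@[simp] theorem deckFactor_T_zpow (Q : BinQF) (j : ℤ) : deckFactor Q (T ^ j) = 1 := by
  rw [deckFactor]
  have h0 : (T ^ j) 1 0 = 0 := by
    show (T ^ j).1 1 0 = 0; rw [ModularGroup.coe_T_zpow]; rfl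
  have h1 : (T ^ j) 0 0 = 1 := by
    show (T ^ j).1 0 0 = 1; rw [ModularGroup.coe_T_zpow]; rfl
  rw [h0, h1]; simp

/-- **`P_{Q·T^j}(t) = T^{-j} • P_Q(t)`** (`A > 0`). [folklore] -/
theorem axisPt₀_smul_T_zpow (hA : 0 < Q.a) (hΔ : 0 < Q.disc) (j : ℤ)
    (hA' : 0 < (smul Q (T ^ j)).a) (hΔ' : 0 < (smul Q (T ^ j)).disc) {t : ℝ} (ht : 0 < t) :
    axisPt₀ (smul Q (T ^ j)) hA' hΔ' t = (T ^ j)⁻¹ • axisPt₀ Q hA hΔ t := by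
  rw [eq_inv_smul_iff, axisPt₀_of_pos hA' hΔ' ht, axisPt₀_of_pos hA hΔ ht,
    smul_axisPt_smul hA hΔ (T ^ j) hA' hΔ' ht]
  exact axisPt_congr hA hΔ _ _ (by rw [deckFactor_T_zpow, one_mul])

/-- **`𝒲_φ(Q·T^j) = 𝒲_φ(Q)`** for `T`-invariant `φ`. [folklore] -/
theorem geodWeight_smul_T_zpow {φ : ℍ → ℂ} (hT : ∀ z : ℍ, φ (T • z) = φ z) (hA : Q.a ≠ 0)
    (hΔ : 0 < Q.disc) (j : ℤ) : geodWeight φ (smul Q (T ^ j)) = geodWeight φ Q := by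
  rcases lt_or_gt_of_ne hA with hneg | hpos
  · have h1 : 0 < (negForm Q).a := negForm_a_pos.2 hneg
    have h2 : 0 < (negForm Q).disc := by rw [negForm_disc]; exact hΔ
    have hneg' : (smul Q (T ^ j)).a < 0 := by rw [smul_T_zpow_a]; exact hneg
    have hΔj : 0 < (smul Q (T ^ j)).disc := by rw [smul_disc]; exact hΔ
    have h1' : 0 < (negForm (smul Q (T ^ j))).a := negForm_a_pos.2 hneg'
    have h2' : 0 < (negForm (smul Q (T ^ j))).disc := by rw [negForm_disc]; exact hΔj
    have h3 : 0 < (smul (negForm Q) (T ^ j)).a := by rw [smul_negForm]; exact h1'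
    have h4 : 0 < (smul (negForm Q) (T ^ j)).disc := by rw [smul_negForm]; exact h2'
    rw [geodWeight_of_neg φ hneg' hΔj h1' h2', geodWeight_of_neg φ hneg hΔ h1 h2]
    refine setIntegral_congr_fun measurableSet_Ioi fun t ht => ?_
    rw [← axisPt₀_congr_form (smul_negForm Q (T ^ j)) h3 h4 h1' h2',
      axisPt₀_smul_T_zpow h1 h2 j h3 h4 ht, ← zpow_neg, apply_T_zpow_smul hT]
  · have hpos' : 0 < (smul Q (T ^ j)).a := by rw [smul_T_zpow_a]; exact hpos
    have hΔj : 0 < (smul Q (T ^ j)).disc := by rw [smul_disc]; exact hΔ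
    rw [geodWeight_of_pos φ hpos' hΔj, geodWeight_of_pos φ hpos hΔ]
    refine setIntegral_congr_fun measurableSet_Ioi fun t ht => ?_
    rw [axisPt₀_smul_T_zpow hpos hΔ j hpos' hΔj ht, ← zpow_neg, apply_T_zpow_smul hT]

/-- `𝒲_φ(tred Q) = 𝒲_φ(Q)` for `T`-invariant `φ`. [folklore] -/
theorem geodWeight_tred {φ : ℍ → ℂ} (hT : ∀ z : ℍ, φ (T • z) = φ z) (hA : Q.a ≠ 0)
    (hΔ : 0 < Q.disc) : geodWeight φ (tred Q) = geodWeight φ Q :=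
  geodWeight_smul_T_zpow hT hA hΔ _

/-- `κ(−R, g) = κ(R, g)⁻¹` (the roots are exchanged). [folklore] -/
theorem deckFactor_negForm (R : BinQF) (g : SL(2, ℤ)) :
    deckFactor (negForm R) g = (deckFactor R g)⁻¹ := by
  rw [deckFactor, deckFactor, rootPlus_negForm, rootMinus_negForm, inv_div]

end invariance

/-! ### The reflected kernel: `𝒲_φ(Q♭) = 𝒲_{φ∘ρ}(Q)` -/

section flat

variable {Q : BinQF}

/-- The roots of `−Q♭ = [A, −B, C]` are `−θ∓`. [folklore] -/
theorem rootPlus_negForm_flat (Q : BinQF) : rootPlus (negForm (flat Q)) = -rootMinus Q := by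
  rw [rootPlus, rootMinus, sqrtDisc, sqrtDisc, negForm_disc, flat_disc]
  simp only [negForm_a, negForm_b, flat_a, flat_b, neg_neg]
  push_cast
  ring

/-- The roots of `−Q♭ = [A, −B, C]` are `−θ∓`. [folklore] -/
theorem rootMinus_negForm_flat (Q : BinQF) : rootMinus (negForm (flat Q)) = -rootPlus Q := by
  rw [rootPlus, rootMinus, sqrtDisc, sqrtDisc, negForm_disc, flat_disc]
  simp only [negForm_a, negForm_b, flat_a, flat_b, neg_neg]
  push_cast
  ring

/-- **The geodesic of `Q♭` traversed forwards is the reflection of that of `Q` traversed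
backwards**: `P_{−Q♭}(t) = ρ(P_Q(t⁻¹))` as complex numbers (`t ≠ 0`). [folklore] -/
theorem axisPtC_negForm_flat (Q : BinQF) {t : ℝ} (ht : t ≠ 0) :
    axisPtC (negForm (flat Q)) t = reflectC (axisPtC Q t⁻¹) := by
  apply Complex.ext
  · rw [reflectC_re, axisPtC_re, axisPtC_re, rootPlus_negForm_flat, rootMinus_negForm_flat]
    field_simp
    ring
  · rw [reflectC_im, axisPtC_im, axisPtC_im, rootPlus_negForm_flat, rootMinus_negForm_flat]
    field_simp
    ring

/-- The same on `ℍ`: `P_{−Q♭}(t) = ρ(P_Q(t⁻¹))` for `t > 0` (`A > 0`). [folklore] -/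
theorem axisPt₀_negForm_flat (hA : 0 < Q.a) (hΔ : 0 < Q.disc) (hA' : 0 < (negForm (flat Q)).a)
    (hΔ' : 0 < (negForm (flat Q)).disc) {t : ℝ} (ht : 0 < t) :
    axisPt₀ (negForm (flat Q)) hA' hΔ' t = reflect (axisPt₀ Q hA hΔ t⁻¹) := by
  apply UpperHalfPlane.ext
  rw [coe_axisPt₀_of_pos hA' hΔ' ht, coe_reflect, coe_axisPt₀_of_pos hA hΔ (inv_pos.2 ht)]
  exact axisPtC_negForm_flat Q ht.ne'

/-- **`𝒲_φ(Q♭) = 𝒲_{φ∘ρ}(Q)`**: the weight of the reflected form is the weight of the reflected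
kernel (`A > 0`, `Δ > 0`; the measure `dt/t` is inversion invariant).
[cite: Toth2000, main theorem (sums over closed geodesics; cf. Ngo2024 §1)] -/
theorem geodWeight_flat (φ : ℍ → ℂ) (hA : 0 < Q.a) (hΔ : 0 < Q.disc) :
    geodWeight φ (flat Q) = geodWeight (fun z => φ (reflect z)) Q := by
  have hneg : (flat Q).a < 0 := by rw [flat_a, neg_lt_zero]; exact hA
  have hΔ' : 0 < (flat Q).disc := by rw [flat_disc]; exact hΔ
  have h1 : 0 < (negForm (flat Q)).a := negForm_a_pos.2 hneg
  have h2 : 0 < (negForm (flat Q)).disc := by rw [negForm_disc]; exact hΔ'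
  rw [geodWeight_of_neg φ hneg hΔ' h1 h2, geodWeight_of_pos _ hA hΔ,
    ← integral_Ioi_comp_div_div (fun u => φ (reflect (axisPt₀ Q hA hΔ u))) one_pos]
  refine setIntegral_congr_fun measurableSet_Ioi fun t ht => ?_
  simp only [one_div]
  rw [axisPt₀_negForm_flat hA hΔ h1 h2 ht]

/-- `ρ`-reflection of the standard kernel flips the frequency: `e(η Re ρz)Ψ(Im ρz) = e(−η Re z)Ψ(Im z)`.
[folklore] -/
theorem kernel_reflect (η : ℝ) (Ψ : ℝ → ℂ) (z : ℍ) :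
    eTwoPi (η * ((reflect z : ℍ) : ℂ).re) * Ψ ((reflect z : ℍ) : ℂ).im =
      eTwoPi (-η * (z : ℂ).re) * Ψ (z : ℂ).im := by
  rw [coe_reflect, reflectC_re, reflectC_im]
  ring_nf

/-- **The geodesic transform is even in the frequency**: `𝒯_{−η}Ψ = 𝒯_ηΨ` (substitute `t ↦ 1/t`).
[folklore] -/
theorem geodTransform_neg (η : ℝ) (Ψ : ℝ → ℂ) (r : ℝ) :
    geodTransform (-η) Ψ r = geodTransform η Ψ r := by
  rw [geodTransform, geodTransform]
  rw [← integral_Ioi_comp_div_div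
    (fun t => eTwoPi (η * (r * ((1 - t ^ 2) / (1 + t ^ 2)))) * Ψ (r * (2 * t / (1 + t ^ 2))))
    one_pos]
  refine setIntegral_congr_fun measurableSet_Ioi fun t ht => ?_
  have ht0 : (t : ℝ) ≠ 0 := ne_of_gt ht
  simp only [one_div]
  congr 2
  · congr 1
    field_simp
    ring
  · congr 1
    field_simp
    ring

/-- For `φ = e(η Re z)Ψ(Im z)` and `A > 0`: **`𝒲_φ(Q♭) = e(−η x₀) 𝒯_ηΨ(r)`** — the reflected forms
contribute the conjugate-frequency Weyl phase with the same radial weight.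
[cite: Toth2000, main theorem (sums over closed geodesics; cf. Ngo2024 §1)] -/
theorem geodWeight_kernel_flat (hA : 0 < Q.a) (hΔ : 0 < Q.disc) (η : ℝ) (Ψ : ℝ → ℂ) :
    geodWeight (fun z : ℍ => eTwoPi (η * (z : ℂ).re) * Ψ (z : ℂ).im) (flat Q) =
      eTwoPi (-η * center Q) * geodTransform η Ψ (radius Q) := by
  rw [geodWeight_flat _ hA hΔ]
  simp_rw [kernel_reflect]
  rw [geodWeight_kernel_of_pos hA hΔ (-η) Ψ, geodTransform_neg]

end flat

/-! ### Unfolding from a base form with `A < 0` -/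

section negbase

variable {g₁ : SL(2, ℤ)}

/-- `T`-reduction of the opposite forms: `TRedOrbit R q ≃ TRedOrbit (−R) q`, `Q ↦ tred(−Q)`.
[folklore] -/
def tredNegEquiv (hsq : ¬ IsSquare R.disc) : TRedOrbit R q ≃ TRedOrbit (negForm R) q where
  toFun Q := ⟨tred (negForm Q.1), isTReduced_tred (by
      rw [negForm_a, neg_ne_zero, ← Q.smul_lift]
      exact a_ne_zero_of_not_isSquare (not_isSquare_smul_disc hsq _)),
    Q.lift * T ^ tExp (negForm Q.1), Subgroup.mul_mem _ Q.lift_mem (Subgroup.zpow_mem _ (by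
      rw [CongruenceSubgroup.Gamma0_mem]; simp [ModularGroup.T]) _), by
      rw [smul_mul, smul_negForm, Q.smul_lift]; rfl⟩
  invFun Q := ⟨tred (negForm Q.1), isTReduced_tred (by
      rw [negForm_a, neg_ne_zero, ← Q.smul_lift]
      exact a_ne_zero_of_not_isSquare (not_isSquare_smul_disc
        (show ¬ IsSquare (negForm R).disc by rw [negForm_disc]; exact hsq) _)),
    Q.lift * T ^ tExp (negForm Q.1), Subgroup.mul_mem _ Q.lift_mem (Subgroup.zpow_mem _ (by
      rw [CongruenceSubgroup.Gamma0_mem]; simp [ModularGroup.T]) _), by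
      rw [smul_mul, ← negForm_negForm (smul R Q.lift), ← smul_negForm, Q.smul_lift]; rfl⟩
  left_inv Q := by
    apply Subtype.ext
    have hA : Q.1.a ≠ 0 := by
      rw [← Q.smul_lift]; exact a_ne_zero_of_not_isSquare (not_isSquare_smul_disc hsq _)
    have e1 : negForm (tred (negForm Q.1)) = smul Q.1 (T ^ tExp (negForm Q.1)) := by
      rw [tred, ← smul_negForm, negForm_negForm]
    show tred (negForm (tred (negForm Q.1))) = Q.1
    rw [e1, tred_smul_T_zpow hA, tred_eq_self hA Q.isTReduced]
  right_inv Q := by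
    apply Subtype.ext
    have hA : Q.1.a ≠ 0 := by
      rw [← Q.smul_lift]
      exact a_ne_zero_of_not_isSquare (not_isSquare_smul_disc
        (show ¬ IsSquare (negForm R).disc by rw [negForm_disc]; exact hsq) _)
    have e1 : negForm (tred (negForm Q.1)) = smul Q.1 (T ^ tExp (negForm Q.1)) := by
      rw [tred, ← smul_negForm, negForm_negForm]
    show tred (negForm (tred (negForm Q.1))) = Q.1
    rw [e1, tred_smul_T_zpow hA, tred_eq_self hA Q.isTReduced]

/-- The underlying form of `tredNegEquiv Q` is `tred(−Q)`. [folklore] -/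
theorem tredNegEquiv_val (hsq : ¬ IsSquare R.disc) (Q : TRedOrbit R q) :
    (tredNegEquiv hsq Q).1 = tred (negForm Q.1) := rfl

/-- **Unfolding from a base form with `A < 0`.**  For `R.a < 0` (non-square `Δ > 0`) the closed
geodesic of `R` is that of `−R`; with the deck generator `g₁` of `stab_q(R)` normalised by
`κ(R, g₁) < 1` the cycle integral of `P_φ` over one period again equals the sum of the weights
over the `T`-reduced forms of the `Γ₀(q)`-orbit of `R`.
[cite: Toth2000, main theorem (sums over closed geodesics; cf. Ngo2024 §1)] -/
theorem cycleIntegral_poincareFn_eq_tsum_of_neg (hA : R.a < 0) (hΔ : 0 < R.disc)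
    (hsq : ¬ IsSquare R.disc) (hA' : 0 < (negForm R).a) (hΔ' : 0 < (negForm R).disc)
    (hg₁ : g₁ ∈ stabLevel R q) (hκ : deckFactor R g₁ < 1)
    (hgen : ∀ g ∈ stabLevel R q, ∃ k : ℤ, g = g₁ ^ k ∨ g = -g₁ ^ k)
    {φ : ℍ → ℂ} (hφc : Continuous φ) (hT : ∀ z : ℍ, φ (T • z) = φ z)
    {Y : ℝ} (hsupp : ∀ z : ℍ, z.im < Y → φ z = 0) (hY : 0 < Y) :
    ∫ t in (deckFactor R g₁)..1, poincareFn q φ (axisPt₀ (negForm R) hA' hΔ' t) / t =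
      ∑' Q : TRedOrbit R q, geodWeight φ Q.1 := by
  have hsq' : ¬ IsSquare (negForm R).disc := by rw [negForm_disc]; exact hsq
  have hstab : stabLevel (negForm R) q = stabLevel R q := by
    ext s; rw [mem_stabLevel_iff, mem_stabLevel_iff, mem_stab_negForm_iff]
  have hg₁' : g₁⁻¹ ∈ stabLevel (negForm R) q := by rw [hstab]; exact Subgroup.inv_mem _ hg₁
  have hκ' : deckFactor (negForm R) g₁⁻¹ < 1 := by
    rw [deckFactor_negForm, deckFactor_inv hA.ne hΔ hg₁.1, inv_inv]; exact hκ
  have hgen' : ∀ g ∈ stabLevel (negForm R) q, ∃ k : ℤ, g = (g₁⁻¹) ^ k ∨ g = -(g₁⁻¹) ^ k := by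
    intro g hg
    rw [hstab] at hg
    obtain ⟨k, hk⟩ := hgen g hg
    refine ⟨-k, ?_⟩
    rw [inv_zpow', neg_neg]
    exact hk
  have key := cycleIntegral_poincareFn_eq_tsum hA' hΔ' hsq' hg₁' hκ' hgen' hφc hT hsupp hY
  rw [deckFactor_negForm, deckFactor_inv hA.ne hΔ hg₁.1, inv_inv] at key
  rw [key, ← Equiv.tsum_eq (tredNegEquiv hsq)]
  refine tsum_congr fun Q => ?_
  have hAQ : Q.1.a ≠ 0 := by
    rw [← Q.smul_lift]; exact a_ne_zero_of_not_isSquare (not_isSquare_smul_disc hsq _)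
  have hΔQ : 0 < Q.1.disc := by rw [← Q.smul_lift, smul_disc]; exact hΔ
  rw [tredNegEquiv_val, geodWeight_tred hT (by rw [negForm_a, neg_ne_zero]; exact hAQ)
    (by rw [negForm_disc]; exact hΔQ), geodWeight_negForm φ hAQ hΔQ]

end negbase

-- `LevelEquiv`, `orbitRep` and their lemmas come from `QuadraticRootsTothWeylSum.lean` (Part 2).


/-! ### The orbit-sum identity -/

section orbitsum

/-- **Small geodesics carry no weight**: if `√Δ/(2|A|) < Y` and `φ` vanishes below height `Y`
then `𝒲_φ(Q) = 0`. [cite: Toth2000, main theorem (sums over closed geodesics; cf. Ngo2024 §1)] -/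
theorem geodWeight_eq_zero_of_radius_lt {φ : ℍ → ℂ} {Y : ℝ} (hsupp : ∀ z : ℍ, z.im < Y → φ z = 0)
    {Q : BinQF} (hA : Q.a ≠ 0) (hΔ : 0 < Q.disc)
    (hr : sqrtDisc Q / (2 * |(Q.a : ℝ)|) < Y) : geodWeight φ Q = 0 := by
  -- reduce to a form with positive first coefficient and the same `√Δ/(2|A|)`
  suffices key : ∀ (P : BinQF) (hP : 0 < P.a) (hΔP : 0 < P.disc), radius P < Y →
      ∫ t in Set.Ioi 0, φ (axisPt₀ P hP hΔP t) / t = 0 by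
    rcases lt_or_gt_of_ne hA with hneg | hpos
    · have h1 : 0 < (negForm Q).a := negForm_a_pos.2 hneg
      have h2 : 0 < (negForm Q).disc := by rw [negForm_disc]; exact hΔ
      rw [geodWeight_of_neg φ hneg hΔ h1 h2]
      apply key
      rw [radius, sqrtDisc_negForm, negForm_a, Int.cast_neg]
      have : |(Q.a : ℝ)| = -Q.a := abs_of_neg (by exact_mod_cast hneg)
      rw [this] at hr
      convert hr using 2
    · rw [geodWeight_of_pos φ hpos hΔ]
      apply key
      rw [radius]
      have : |(Q.a : ℝ)| = Q.a := abs_of_pos (by exact_mod_cast hpos)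
      rwa [this] at hr
  intro P hP hΔP hrad
  refine setIntegral_eq_zero_of_forall_eq_zero fun t ht => ?_
  rw [hsupp _ ?_, zero_div]
  rw [← UpperHalfPlane.coe_im, coe_axisPt₀_of_pos hP hΔP ht]
  exact (axisPtC_im_le (radius_pos hP hΔP).le t).trans_lt hrad

variable {a b c : ℤ} {d N : ℕ}

/-- A `T`-reduced level form with `0 < |A| ≤ aN` lies in `levelFormsUpTo ∪ (levelFormsUpTo)♭`.
[folklore] -/
theorem mem_union_of_isLevelForm (ha : 0 < a) {Q : BinQF}
    (hQ : IsLevelForm a b (discrim a b c) (a.toNat * d) Q) (hT : IsTReduced Q) (hA : Q.a ≠ 0)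
    (hle : |Q.a| ≤ a * N) :
    Q ∈ levelFormsUpTo a b c d N ∪ (levelFormsUpTo a b c d N).image flat := by
  rcases lt_or_gt_of_ne hA with hneg | hpos
  · apply Finset.mem_union_right
    refine Finset.mem_image.2 ⟨flat Q, ?_, flat_flat Q⟩
    rw [mem_levelFormsUpTo ha]
    refine ⟨isLevelForm_flat_iff.2 hQ, flat_a_pos_iff.2 hneg, ?_, isTReduced_flat_iff.2 hT⟩
    rw [flat_a]; rw [abs_of_neg hneg] at hle; exact hle
  · apply Finset.mem_union_left
    rw [mem_levelFormsUpTo ha]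
    refine ⟨hQ, hpos, ?_, hT⟩
    rw [abs_of_pos hpos] at hle; exact hle

/-- Members of `levelFormsUpTo ∪ (levelFormsUpTo)♭` are `T`-reduced level forms with `A ≠ 0`.
[folklore] -/
theorem of_mem_union (ha : 0 < a) {Q : BinQF}
    (hQ : Q ∈ levelFormsUpTo a b c d N ∪ (levelFormsUpTo a b c d N).image flat) :
    IsLevelForm a b (discrim a b c) (a.toNat * d) Q ∧ IsTReduced Q ∧ Q.a ≠ 0 := by
  rcases Finset.mem_union.1 hQ with h | h
  · obtain ⟨h1, h2, -, h4⟩ := (mem_levelFormsUpTo ha).1 h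
    exact ⟨h1, h4, h2.ne'⟩
  · obtain ⟨Q', hQ', rfl⟩ := Finset.mem_image.1 h
    obtain ⟨h1, h2, -, h4⟩ := (mem_levelFormsUpTo ha).1 hQ'
    exact ⟨isLevelForm_flat_iff.2 h1, isTReduced_flat_iff.2 h4, by rw [flat_a]; omega⟩

/-- **The orbit-sum identity** (Tóth's analogue of DFI (14), combinatorial form).
Let `f = ax² + bx + c` with `a > 0` and non-square `Δ = b² − 4ac > 0`, `d ≥ 1`, `q = ad`, and
let `φ` be a continuous kernel on `ℍ`, invariant under `z ↦ z + 1` and vanishing below the height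
`Y > 0`.  If `aN ≥ √Δ/(2Y)` then

  `∑_{Q ∈ levelFormsUpTo a b c d N} (𝒲_φ(Q) + 𝒲_φ(Q♭)) = ∑_{R} ∫_{κ_R}^{1} P_φ(P_R(t)) dt/t`,

where `R` runs over the representatives `orbitRep q` of the `Γ₀(q)`-orbits met by these forms and,
for each `R`, `g R` is any deck generator of `stab_q(R)` (`κ_R = κ(R, g R) < 1`,
`stab_q(R) = {±(g R)^k}`; they exist by `exists_deck_generator`), the integral being taken along
one period of the closed geodesic of `R` on `Γ₀(q)∖ℍ`.  Together with
`sum_weylSum_eq_sum_levelForms`, `geodWeight_kernel_of_pos` and `geodWeight_kernel_flat` this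
expresses `∑_{d ∣ n} 𝒯Ψ(√Δ/2an) ∑_{f(ν) ≡ 0 (n)} [e(−hν/n)e(−hb/2an) + e(hν/n)e(hb/2an)]` as a sum of
cycle integrals of the single Poincaré series `P_φ`, `φ = e(−h Re z)Ψ(Im z)`.
[cite: Toth2000, main theorem (sums over closed geodesics; cf. Ngo2024 §1)] -/
theorem sum_geodWeight_levelFormsUpTo_eq (ha : 0 < a) (hΔ : 0 < discrim a b c)
    (hsq : ¬ IsSquare (discrim a b c))
    {φ : ℍ → ℂ} (hφc : Continuous φ) (hT : ∀ z : ℍ, φ (T • z) = φ z)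
    {Y : ℝ} (hY : 0 < Y) (hsupp : ∀ z : ℍ, z.im < Y → φ z = 0)
    (hN : Real.sqrt ((discrim a b c : ℤ) : ℝ) / (2 * Y) ≤ a * N)
    (g : BinQF → SL(2, ℤ))
    (hg : ∀ R ∈ (levelFormsUpTo a b c d N ∪ (levelFormsUpTo a b c d N).image flat).image
        (orbitRep (a.toNat * d)),
      g R ∈ stabLevel R (a.toNat * d) ∧ deckFactor R (g R) < 1 ∧
        ∀ s ∈ stabLevel R (a.toNat * d), ∃ k : ℤ, s = g R ^ k ∨ s = -g R ^ k) :
    ∑ Q ∈ levelFormsUpTo a b c d N, (geodWeight φ Q + geodWeight φ (flat Q)) =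
      ∑ R ∈ (levelFormsUpTo a b c d N ∪ (levelFormsUpTo a b c d N).image flat).image
          (orbitRep (a.toNat * d)),
        ∫ t in (deckFactor R (g R))..1, poincareFn (a.toNat * d) φ (axisPt₁ R t) / t := by
  classical
  set q : ℕ := a.toNat * d with hq
  set LN := levelFormsUpTo a b c d N with hLN
  set L := LN ∪ LN.image flat with hL
  have haq : a ∣ (q : ℤ) := by rw [hq, level_cast ha]; exact dvd_mul_right a d
  -- Step 1: the two-signed sum as a sum over `L`
  have hdisj : Disjoint LN (LN.image flat) := by
    rw [Finset.disjoint_left]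
    intro Q hQ hQ'
    obtain ⟨Q', hQ'', rfl⟩ := Finset.mem_image.1 hQ'
    have h1 := ((mem_levelFormsUpTo ha).1 hQ).2.1
    have h2 := ((mem_levelFormsUpTo ha).1 hQ'').2.1
    rw [flat_a] at h1; omega
  have hstep1 : ∑ Q ∈ LN, (geodWeight φ Q + geodWeight φ (flat Q)) = ∑ Q ∈ L, geodWeight φ Q := by
    rw [Finset.sum_add_distrib, hL, Finset.sum_union hdisj, Finset.sum_image]
    intro x _ y _ h; exact flat_injective h
  rw [hstep1]
  -- Step 2: group by orbit representative
  rw [← Finset.sum_fiberwise_of_maps_to (g := orbitRep q) (t := L.image (orbitRep q))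
    (fun Q hQ => Finset.mem_image_of_mem _ hQ)]
  refine Finset.sum_congr rfl fun R hR => ?_
  obtain ⟨Q₀, hQ₀, hRQ₀⟩ := Finset.mem_image.1 hR
  obtain ⟨hQ₀lev, hQ₀T, hQ₀A⟩ := of_mem_union ha hQ₀
  have hRQ : LevelEquiv q R Q₀ := hRQ₀ ▸ levelEquiv_orbitRep Q₀
  have hRrep : orbitRep q R = R := by rw [← hRQ₀]; exact orbitRep_orbitRep Q₀
  -- `R` is a level form with `A ≠ 0`, `Δ > 0` non-square
  have hRlev : IsLevelForm a b (discrim a b c) q R := by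
    obtain ⟨γ, hγ, hγQ⟩ := hRQ
    have := hQ₀lev.smul_inv haq hγ
    rwa [← hγQ, smul_mul_inv] at this
  have hRdisc : R.disc = discrim a b c := hRlev.disc_eq
  have hRΔ : 0 < R.disc := by rw [hRdisc]; exact hΔ
  have hRsq : ¬ IsSquare R.disc := by rw [hRdisc]; exact hsq
  have hRA : R.a ≠ 0 := a_ne_zero_of_not_isSquare hRsq
  obtain ⟨hgR, hκR, hgenR⟩ := hg R hR
  -- Step 3: the fibre sum is the orbit `tsum`
  have hfibre : ∑ Q ∈ L with orbitRep q Q = R, geodWeight φ Q =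
      ∑' Q : TRedOrbit R q, geodWeight φ Q.1 := by
    have e1 : (∑' Q : TRedOrbit R q, geodWeight φ Q.1) =
        ∑' Q : BinQF, Set.indicator {Q | IsTReduced Q ∧ LevelEquiv q R Q} (geodWeight φ) Q :=
      tsum_subtype {Q | IsTReduced Q ∧ LevelEquiv q R Q} (geodWeight φ)
    rw [e1, tsum_eq_sum (s := L.filter (fun Q => orbitRep q Q = R))]
    · refine Finset.sum_congr rfl fun Q hQ => ?_
      rw [Finset.mem_filter] at hQ
      rw [Set.indicator_of_mem]
      exact ⟨(of_mem_union ha hQ.1).2.1, by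
        have := levelEquiv_orbitRep (q := q) Q; rwa [hQ.2] at this⟩
    · intro Q hQ
      by_cases hmem : Q ∈ {Q | IsTReduced Q ∧ LevelEquiv q R Q}
      · rw [Set.indicator_of_mem hmem]
        obtain ⟨hQT, hQR⟩ := hmem
        -- a `T`-reduced form of the orbit outside `L` has `|A| > aN ≥ √Δ/(2Y)`
        have hQlev : IsLevelForm a b (discrim a b c) q Q := by
          obtain ⟨γ, hγ, rfl⟩ := hQR; exact hRlev.smul haq hγ
        have hQA : Q.a ≠ 0 := a_ne_zero_of_not_isSquare (by rw [hQlev.disc_eq]; exact hsq)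
        have hQΔ : 0 < Q.disc := by rw [hQlev.disc_eq]; exact hΔ
        have hbig : a * N < |Q.a| := by
          by_contra hle
          push Not at hle
          apply hQ
          rw [Finset.mem_filter]
          refine ⟨mem_union_of_isLevelForm ha hQlev hQT hQA hle, ?_⟩
          rw [← orbitRep_eq_of_levelEquiv hQR, hRrep]
        apply geodWeight_eq_zero_of_radius_lt hsupp hQA hQΔ
        have hApos : (0 : ℝ) < |(Q.a : ℝ)| := abs_pos.2 (by exact_mod_cast hQA)
        rw [div_lt_iff₀ (by positivity), sqrtDisc, hQlev.disc_eq]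
        rw [div_le_iff₀ (by positivity)] at hN
        have h1 : ((a * N : ℤ) : ℝ) < |(Q.a : ℝ)| := by
          rw [← Int.cast_abs]; exact_mod_cast hbig
        push_cast at h1
        nlinarith
      · exact Set.indicator_of_notMem hmem _
  rw [hfibre]
  -- Step 4: unfold the orbit
  rcases lt_or_gt_of_ne hRA with hneg | hpos
  · have h1 : 0 < (negForm R).a := negForm_a_pos.2 hneg
    have h2 : 0 < (negForm R).disc := by rw [negForm_disc]; exact hRΔ
    rw [← cycleIntegral_poincareFn_eq_tsum_of_neg hneg hRΔ hRsq h1 h2 hgR hκR hgenR hφc hT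
      hsupp hY]
    refine intervalIntegral.integral_congr fun t _ => ?_
    show poincareFn q φ (axisPt₀ (negForm R) h1 h2 t) / (t : ℂ) = poincareFn q φ (axisPt₁ R t) / (t : ℂ)
    rw [axisPt₁_of_neg hneg hRΔ h1 h2]
  · rw [← cycleIntegral_poincareFn_eq_tsum hpos hRΔ hRsq hgR hκR hgenR hφc hT hsupp hY]
    refine intervalIntegral.integral_congr fun t _ => ?_
    show poincareFn q φ (axisPt₀ R hpos hRΔ t) / (t : ℂ) = poincareFn q φ (axisPt₁ R t) / (t : ℂ)
    rw [axisPt₁_of_pos hpos hRΔ]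

/-- **Existence of deck generators for all representatives** (so that the orbit-sum identity
applies): a choice `g` as required by `sum_geodWeight_levelFormsUpTo_eq`.
[cite: Toth2000, main theorem (closed geodesics; cf. Ngo2024 §1)] -/
theorem exists_deck_generators (ha : 0 < a) (hd : 0 < d) (hΔ : 0 < discrim a b c)
    (hsq : ¬ IsSquare (discrim a b c)) :
    ∃ g : BinQF → SL(2, ℤ),
      ∀ R ∈ (levelFormsUpTo a b c d N ∪ (levelFormsUpTo a b c d N).image flat).image
          (orbitRep (a.toNat * d)),
        g R ∈ stabLevel R (a.toNat * d) ∧ deckFactor R (g R) < 1 ∧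
          ∀ s ∈ stabLevel R (a.toNat * d), ∃ k : ℤ, s = g R ^ k ∨ s = -g R ^ k := by
  classical
  set q : ℕ := a.toNat * d with hq
  haveI : NeZero q := ⟨by rw [hq]; exact Nat.mul_ne_zero (by omega) hd.ne'⟩
  have haq : a ∣ (q : ℤ) := by rw [hq, level_cast ha]; exact dvd_mul_right a d
  -- every representative has `A ≠ 0` and non-square `Δ > 0`
  have key : ∀ R ∈ (levelFormsUpTo a b c d N ∪ (levelFormsUpTo a b c d N).image flat).image
      (orbitRep q), R.a ≠ 0 ∧ 0 < R.disc ∧ ¬ IsSquare R.disc := by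
    intro R hR
    obtain ⟨Q₀, hQ₀, hRQ₀⟩ := Finset.mem_image.1 hR
    obtain ⟨hQ₀lev, -, -⟩ := of_mem_union ha hQ₀
    have hRQ : LevelEquiv q R Q₀ := hRQ₀ ▸ levelEquiv_orbitRep Q₀
    have hRlev : IsLevelForm a b (discrim a b c) q R := by
      obtain ⟨γ, hγ, hγQ⟩ := hRQ
      have := hQ₀lev.smul_inv haq hγ
      rwa [← hγQ, smul_mul_inv] at this
    have hRsq : ¬ IsSquare R.disc := by rw [hRlev.disc_eq]; exact hsq
    exact ⟨a_ne_zero_of_not_isSquare hRsq, by rw [hRlev.disc_eq]; exact hΔ, hRsq⟩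
  refine ⟨fun R => if h : R.a ≠ 0 ∧ 0 < R.disc ∧ ¬ IsSquare R.disc then
      Classical.choose (exists_deck_generator h.1 h.2.1 h.2.2 q) else 1, ?_⟩
  intro R hR
  have h := key R hR
  simp only [dif_pos h]
  obtain ⟨h1, h2, h3⟩ := Classical.choose_spec (exists_deck_generator h.1 h.2.1 h.2.2 q)
  exact ⟨h1, h2, h3⟩

end orbitsum

end RootForms

end Literature.NumberTheory.Sieve
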